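import Literature.NumberTheory.EllipticCurves.KatoFineSelmerDual
import Literature.NumberTheory.EllipticCurves.IwasawaSelmer
import Literature.NumberTheory.EllipticCurves.GeomPointsGaloisModule
import Literature.NumberTheory.EllipticCurves.PeriodIndexCorestrictionLocal
import HarnessLib

/-!
# The fine Selmer group is contained in the classical Selmer group over a `ℤ_p`-extension:
# `Sel₀(K_∞, E[p^∞]) ≤ Sel_{p^∞}(E/K_∞)` — the bridge between the tree's two Selmer libraries
# (`GreenbergSelmer` decomposition-group conditions vs `SubgroupSelmer` completion conditions);
# kernel plumbing for the CONGRUENCE ROAD to crux stmt-BirchSwinnertonDyer-19386 (a `--supports … --as helper`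
# file; seat `bsd-potss-k9-c4` g3; nothing booked, BSD is not proved by any of this)

WHY. The congruence road (`Theorems/KatoDescentPotSupersingularWildFineSelmerCongruenceRoad.lean`):
Coates–Sujatha's (A) at `(E,3)` — the K9 crux `WildFineSelmerCoatesSujatha` on a row — follows from
(A) at `(E′,3)` for ONE congruent curve `E′` (Lim–Sujatha 2018 Prop. 3.2). On the 344 Cartan-normaliser
rows no Kato unit anchor exists (same mod-3 image), but a GOOD ORDINARY anchor `E′` certifies (A)
through the CLASSICAL Iwasawa theory of `E′` (Greenberg–Vatsal / Greenberg's Thm. 4.1 / Kato 17.4: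
`μ(X(E′/ℚ^cyc)) = 0`, all typed in the tree for the classical Selmer group `WeierstrassCurve.selmerInfty`)
— PROVIDED the fine Selmer group of the tree (`WeierstrassCurve.fineSelmerInfty`, library
`GreenbergSelmer`/`KatoFineSelmerDual`: classes of `H¹(K_∞, E[p^∞])` killed by restriction to the
DECOMPOSITION GROUPS `ker κ ⊓ D_v ≤ Γ_K`) is known to lie inside the classical Selmer group
(`WeierstrassCurve.selmerInfty`, library `SubgroupSelmer`/`IwasawaSelmer`: classes dying in
`H¹((ker κ)_{K_v}, E(K̄_v))` for the COMPLETIONS `K_v`, pulled back along `Γ_{K_v} → Γ_K`). In print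
this is a tautology ("`R(E/L) ⊂ S(E/L)`", Coates–Sujatha 2005 §3; Wuthrich 2007); in the kernel the two
local conditions live in different groups. This file proves the inclusion, for EVERY number field
`K`, prime `p`, elliptic-curve model `W/K` and `ℤ_p`-extension `κ`:

* §1 (pure group cohomology, any topological group): `resH1Hom_oneCocycleClass_eq_zero_of_principal`
  (a crossed homomorphism principal on the range of `θ` dies under the map of ANY compatible pair
  `(θ, ψ)`), `exists_principal_of_resH1Hom_oneCocycleClass_eq_zero` (converse for `ψ` bijective —
  the X11b `LocBridge` lemma, re-proved to keep imports small), and the TRANSFER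
  `resH1Hom_eq_zero_of_resH1Hom_eq_zero_of_range`: if `(θ₁, ψ₁)` has `ψ₁` bijective and
  `range θ₂ ⊆ range θ₁`, then `ker res_{(θ₁,ψ₁)} ≤ ker res_{(θ₂,ψ₂)}`.
* §2 (the three local bridges): `localKerOver_of_mem_awayKer` (finite `v ∤ p`: `D_v` is by DEFINITION
  the range of `Γ_{K_v} → Γ_K`, `GreenbergSelmer.decomp`, and `resGal = absGaloisRestrict`
  definitionally, `resGal_eq_absGaloisRestrict`), `localKerOver_of_mem_strictKer_fineLocalDatum`
  (`v ∣ p`: the strict condition for the fine datum `M⁺ = 0`, coefficients `M ⧸ ⊥ ≅ M`),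
  `localKerOver_completion_of_mem_infKer` (infinite places).
* §3 **`FineSelmerLeSelmer.fineSelmerInfty_le_selmerInfty : W.fineSelmerInfty κ ≤ W.selmerInfty κ`**, and
  the pointwise corollary on `p`-torsion classes used by Nakayama-type finiteness transfers
  (`finite_fineSelmerInfty_pTorsion_of_finite_selmerInfty_pTorsion`).

HONEST FRAMING: kernel plumbing between two existing tree objects; no named fact; no item closed;
the ordinary-anchor certificate itself (classical `μ = 0` ⟹ `Sel[p]` finite ⟹ `Sel₀[p]` finite ⟹
`X₀` f.g./`ℤ_p`) is assembled by the consumer. References: J. Coates, R. Sujatha, Math. Ann. 331 (2005)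
§3 (`R(E/F_∞) ⊂ S(E/F_∞)`); R. Greenberg, Adv. Stud. Pure Math. 17 (1989) p. 98; R. Greenberg, LNM
1716 (1999) §2; J.-P. Serre, *Galois Cohomology* I.§2.4–2.5, I.§5.1, II.§1.1.
-/

set_option autoImplicit false
-- sibling precedent (`KatoDescentPotSupersingularAssembly.lean`): the directory name repeats the summit name
set_option linter.dupNamespace false

noncomputable section

open scoped Classical

universe u

namespace Summit.BirchSwinnertonDyer.BirchSwinnertonDyer.Theorems.FineSelmerLeSelmer

open CategoryTheory NumberField IsDedekindDomain Field
open Literature.NumberTheory.EllipticCurves Literature.NumberTheory.EllipticCurves.GreenbergSelmer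
open Literature.NumberTheory.GaloisRepresentations

/-! ## §1 Group cohomology: principal-on-the-range and the transfer of local triviality -/

section Cohomology

variable {G : Type u} [Group G] [TopologicalSpace G] [IsTopologicalGroup G]
variable {M : Type u} [AddCommGroup M] [DistribMulAction G M] [TopologicalSpace M]
  [DiscreteTopology M]
variable {L₁ : Type u} [Group L₁] [TopologicalSpace L₁] [IsTopologicalGroup L₁]
variable {N₁ : Type u} [AddCommGroup N₁] [DistribMulAction L₁ N₁] [TopologicalSpace N₁]
  [DiscreteTopology N₁]
variable {L₂ : Type u} [Group L₂] [TopologicalSpace L₂] [IsTopologicalGroup L₂]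
variable {N₂ : Type u} [AddCommGroup N₂] [DistribMulAction L₂ N₂] [TopologicalSpace N₂]
  [DiscreteTopology N₂]

/-- **A crossed homomorphism principal on `range θ` dies under the map of ANY compatible pair
`(θ, ψ)`**: if `φ(θ l) = θ l • x − x` for all `l`, then `res_{(θ,ψ)} [φ] = [ψ ∘ φ ∘ θ] = 0` (the
pulled-back cocycle is `l ↦ l • ψ x − ψ x`). No hypothesis on `ψ`. Serre, *Galois Cohomology*,
I.§2.4 and I.§5.1. [folklore] -/
theorem resH1Hom_oneCocycleClass_eq_zero_of_principal (θ : L₂ →ₜ* G) (ψ : M →+ N₂)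
    (h : ∀ (l : L₂) (m : M), ψ (θ l • m) = l • ψ m)
    (φ : contOneCocycles (discreteTopRep G M)) {x : M} (hx : ∀ l : L₂, φ.1 (θ l) = θ l • x - x) :
    resH1Hom θ ψ h (oneCocycleClass _ φ) = 0 := by
  rw [resH1Hom_oneCocycleClass, oneCocycleClass_eq_zero_iff]
  refine ⟨ψ x, fun l ↦ ?_⟩
  change ψ (φ.1 (θ l)) = l • ψ x - ψ x
  rw [hx, map_sub, h]

/-- **Conversely, for a BIJECTIVE coefficient map**: if `res_{(θ,ψ)} [φ] = 0` with `ψ` bijective then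
`φ` is principal on `range θ` (the X11b `LocBridge` criterion, re-proved: a principal cocycle
`l ↦ l • y − y` with `y = ψ x` is `ψ (θ l • x − x)`, and `ψ` is injective).
Serre, *Galois Cohomology*, I.§2.4 and I.§5.1. [folklore] -/
theorem exists_principal_of_resH1Hom_oneCocycleClass_eq_zero (θ : L₁ →ₜ* G) (ψ : M →+ N₁)
    (h : ∀ (l : L₁) (m : M), ψ (θ l • m) = l • ψ m) (hψ : Function.Bijective ψ)
    (φ : contOneCocycles (discreteTopRep G M)) (h0 : resH1Hom θ ψ h (oneCocycleClass _ φ) = 0) :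
    ∃ x : M, ∀ l : L₁, φ.1 (θ l) = θ l • x - x := by
  rw [resH1Hom_oneCocycleClass, oneCocycleClass_eq_zero_iff] at h0
  obtain ⟨y, hy⟩ := h0
  obtain ⟨x, rfl⟩ := hψ.2 y
  refine ⟨x, fun l ↦ hψ.1 ?_⟩
  have hl : ψ (φ.1 (θ l)) = l • ψ x - ψ x := hy l
  rw [hl, map_sub, h]

/-- **TRANSFER of local triviality between two compatible pairs out of the same `H¹_cont(G, M)`.**
If `(θ₁ : L₁ → G, ψ₁)` has `ψ₁` bijective and every `θ₂ l` is some `θ₁ l₁`, then a class killed by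
`res_{(θ₁,ψ₁)}` is killed by `res_{(θ₂,ψ₂)}` (any `ψ₂`). This is the shape in which the tree's two
Selmer libraries meet: `θ₁` the inclusion of `H ⊓ D_v` into `H` (Greenberg), `θ₂` the restriction
`H_{K_v} → H` along `Γ_{K_v} → Γ_K` (classical), whose range lies in `H ⊓ D_v`.
Serre, *Galois Cohomology*, I.§2.4–2.5 and I.§5.1. [folklore] -/
theorem resH1Hom_eq_zero_of_resH1Hom_eq_zero_of_range (θ₁ : L₁ →ₜ* G) (ψ₁ : M →+ N₁)
    (h₁ : ∀ (l : L₁) (m : M), ψ₁ (θ₁ l • m) = l • ψ₁ m) (hψ₁ : Function.Bijective ψ₁)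
    (θ₂ : L₂ →ₜ* G) (ψ₂ : M →+ N₂) (h₂ : ∀ (l : L₂) (m : M), ψ₂ (θ₂ l • m) = l • ψ₂ m)
    (hrange : ∀ l₂ : L₂, ∃ l₁ : L₁, θ₁ l₁ = θ₂ l₂) (c : discreteH1 G M)
    (hc : resH1Hom θ₁ ψ₁ h₁ c = 0) : resH1Hom θ₂ ψ₂ h₂ c = 0 := by
  obtain ⟨φ, rfl⟩ := oneCocycleClass_surjective _ c
  obtain ⟨x, hx⟩ := exists_principal_of_resH1Hom_oneCocycleClass_eq_zero θ₁ ψ₁ h₁ hψ₁ φ hc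
  refine resH1Hom_oneCocycleClass_eq_zero_of_principal θ₂ ψ₂ h₂ φ (x := x) fun l ↦ ?_
  obtain ⟨l₁, hl₁⟩ := hrange l
  rw [← hl₁, hx]

end Cohomology

/-! ## §2 The three local bridges for `E[p^∞]` over `L = K̄^H` -/

section Local

variable {K : Type u} [Field K] [NumberField K] (W : WeierstrassCurve K) (p : ℕ)
  (H : Subgroup (absoluteGaloisGroup K))

/-- **Finite places: Greenberg's "locally trivial at the place above `v`" implies the classical local
condition at the completion `K_v`.** If a class of `H¹(H, E[p^∞])` restricts to zero on `H ⊓ D_v`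
(`GreenbergSelmer.awayKer`; `D_v = range (Γ_{K_v} → Γ_K)` by definition), it dies in
`H¹(H_{K_v}, E(K̄_v))` (`WeierstrassCurve.localKerOver`): the classical local map pulls back along
`H_{K_v} → H`, whose range lies in `H ⊓ D_v` (`resGal = absGaloisRestrict` definitionally), then
pushes coefficients `E[p^∞] ↪ E(K̄) → E(K̄_v)`. Greenberg, LNM 1716 §2 ("one can identify `G_{M_η}`
with … the decomposition subgroup"). [cite: GreenbergLNM1716, §2] -/
theorem localKerOver_of_mem_awayKer (v : HeightOneSpectrum (𝓞 K)) {c : W.subgroupH1 p H}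
    (hc : c ∈ awayKer H (W.geomPrimaryTorsion p) v) :
    c ∈ W.localKerOver p H (v.adicCompletion K) := by
  have hc0 : resH1Hom (subgroupInclusion (inf_le_left : H ⊓ decomp v ≤ H)) (AddMonoidHom.id _)
      (fun _ _ ↦ rfl) c = 0 := hc
  have hrange : ∀ τ : localSubgroupOfEmb H (closureEmb (K := K) (v.adicCompletion K)),
      ∃ l₁ : ↥(H ⊓ decomp v), subgroupInclusion (inf_le_left : H ⊓ decomp v ≤ H) l₁ =
        resGalSubgroupOfEmb H (closureEmb (K := K) (v.adicCompletion K)) τ := fun τ ↦ by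
    have hmem : resGalOfEmb (closureEmb (K := K) (v.adicCompletion K))
        (τ : absoluteGaloisGroup (v.adicCompletion K)) ∈ decomp v := by
      rw [mem_decomp_iff]
      exact ⟨τ, by rw [← WeierstrassCurve.resGal_eq_absGaloisRestrict, resGal_eq]⟩
    exact ⟨⟨_, Subgroup.mem_inf.2 ⟨τ.2, hmem⟩⟩, Subtype.ext rfl⟩
  rw [WeierstrassCurve.mem_localKerOver_iff, WeierstrassCurve.localResOver,
    WeierstrassCurve.localResOverOfEmb]
  exact resH1Hom_eq_zero_of_resH1Hom_eq_zero_of_range _ _ _ Function.bijective_id _ _ _ hrange c hc0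

/-- **Places above `p`: the STRICT condition of the fine datum implies the classical local condition.**
For the fine local datum (`M⁺_v = 0`, `GreenbergSelmer.fineLocalDatum`) the strict map restricts to
`H ⊓ D_v` with coefficients `M ⧸ 0` (a bijective coefficient map), so its kernel transfers to the
classical local kernel at `K_v` exactly as at `v ∤ p`. [cite: Greenberg1989, §1 p. 98] -/
theorem localKerOver_of_mem_strictKer_fineLocalDatum (v : HeightOneSpectrum (𝓞 K))
    {c : W.subgroupH1 p H}
    (hc : c ∈ (fineLocalDatum (W.geomPrimaryTorsion p) v).strictKer H) :
    c ∈ W.localKerOver p H (v.adicCompletion K) := by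
  have hc0 : resH1Hom (decompInToH H v) (fineLocalDatum (W.geomPrimaryTorsion p) v).grMk
      (fun _ _ ↦ rfl) c = 0 := (LocalDatum.mem_strictKer_iff _ _ c).1 hc
  have hbij : Function.Bijective (fineLocalDatum (W.geomPrimaryTorsion p) v).grMk := by
    refine ⟨?_, (fineLocalDatum (W.geomPrimaryTorsion p) v).grMk_surjective⟩
    rw [← AddMonoidHom.ker_eq_bot_iff, LocalDatum.ker_grMk, fineLocalDatum_plus]
  have hrange : ∀ τ : localSubgroupOfEmb H (closureEmb (K := K) (v.adicCompletion K)),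
      ∃ l₁ : decompIn H v, decompInToH H v l₁ =
        resGalSubgroupOfEmb H (closureEmb (K := K) (v.adicCompletion K)) τ := fun τ ↦ by
    have hmem : resGalOfEmb (closureEmb (K := K) (v.adicCompletion K))
        (τ : absoluteGaloisGroup (v.adicCompletion K)) ∈ decomp v := by
      rw [mem_decomp_iff]
      exact ⟨τ, by rw [← WeierstrassCurve.resGal_eq_absGaloisRestrict, resGal_eq]⟩
    exact ⟨⟨⟨_, hmem⟩, (mem_decompIn_iff H v _).2 τ.2⟩, Subtype.ext rfl⟩
  rw [WeierstrassCurve.mem_localKerOver_iff, WeierstrassCurve.localResOver,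
    WeierstrassCurve.localResOverOfEmb]
  exact resH1Hom_eq_zero_of_resH1Hom_eq_zero_of_range _ _ _ hbij _ _ _ hrange c hc0

omit [NumberField K] in
/-- **Infinite places**: locally trivial on `H ⊓ D_w` (`GreenbergSelmer.infKer`,
`D_w = range (Γ_{K_w} → Γ_K)`) implies the classical local condition at the completion `K_w`.
[cite: Greenberg1989, §1 p. 98 (3)] -/
theorem localKerOver_completion_of_mem_infKer (w : InfinitePlace K) {c : W.subgroupH1 p H}
    (hc : c ∈ infKer H (W.geomPrimaryTorsion p) w) :
    c ∈ W.localKerOver p H w.Completion := by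
  have hc0 : resH1Hom (subgroupInclusion (inf_le_left : H ⊓ decompInf w ≤ H)) (AddMonoidHom.id _)
      (fun _ _ ↦ rfl) c = 0 := hc
  have hrange : ∀ τ : localSubgroupOfEmb H (closureEmb (K := K) w.Completion),
      ∃ l₁ : ↥(H ⊓ decompInf w), subgroupInclusion (inf_le_left : H ⊓ decompInf w ≤ H) l₁ =
        resGalSubgroupOfEmb H (closureEmb (K := K) w.Completion) τ := fun τ ↦ by
    have hmem : resGalOfEmb (closureEmb (K := K) w.Completion)
        (τ : absoluteGaloisGroup w.Completion) ∈ decompInf w :=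
      ⟨τ, by rw [← WeierstrassCurve.resGal_eq_absGaloisRestrict, resGal_eq]; rfl⟩
    exact ⟨⟨_, Subgroup.mem_inf.2 ⟨τ.2, hmem⟩⟩, Subtype.ext rfl⟩
  rw [WeierstrassCurve.mem_localKerOver_iff, WeierstrassCurve.localResOver,
    WeierstrassCurve.localResOverOfEmb]
  exact resH1Hom_eq_zero_of_resH1Hom_eq_zero_of_range _ _ _ Function.bijective_id _ _ _ hrange c hc0

end Local

/-! ## §3 `Sel₀(K_∞, E[p^∞]) ≤ Sel_{p^∞}(E/K_∞)` -/

section Infty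

variable {K : Type u} [Field K] [NumberField K] (W : WeierstrassCurve K) {p : ℕ} [Fact p.Prime]
  (κ : ZpExtension K p)

/-- **The fine Selmer group lies in the classical Selmer group over `K_∞`**:
`W.fineSelmerInfty κ ≤ W.selmerInfty κ` — every class of `H¹(K_∞, E[p^∞])` locally trivial at every
place (Greenberg's strict Selmer group of the fine data, decomposition-group conditions) satisfies the
classical local conditions at every completion (it dies in `H¹(K_{∞,w}, E)`, indeed already in
`H¹(K_{∞,w}, E[p^∞])`). Any number field, any `p`, any `ℤ_p`-extension, any model `W`.
"`R(E/F_∞) ⊂ S(E/F_∞)`". [cite: CoatesSujatha2005, §3 (the fine Selmer group as a subgroup of the Selmer group)]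
[cite: GreenbergLNM1716, §2] -/
theorem fineSelmerInfty_le_selmerInfty : W.fineSelmerInfty κ ≤ W.selmerInfty κ := by
  intro c hc
  have hc' := (mem_strictSelmerGroupOver_iff (H := κ.kerSubgroup) (M := W.geomPrimaryTorsion p)
    (L := fineData (W.geomPrimaryTorsion p) p) c).1 hc
  rw [WeierstrassCurve.selmerInfty, WeierstrassCurve.mem_selmerGroupOver_iff]
  refine ⟨fun v σ ↦ ?_, fun w σ ↦ ?_⟩
  · by_cases hv : ((p : ℕ) : 𝓞 K) ∈ v.asIdeal
    · exact localKerOver_of_mem_strictKer_fineLocalDatum W p κ.kerSubgroup v (hc'.2.2 v hv σ)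
    · exact localKerOver_of_mem_awayKer W p κ.kerSubgroup v (hc'.1 v hv σ)
  · exact localKerOver_completion_of_mem_infKer W p κ.kerSubgroup w (hc'.2.1 w σ)

/-- Pointwise corollary for the finiteness transfers (Nakayama for Pontryagin duals): if the `p`-torsion
classes of `Sel_{p^∞}(E/K_∞)` form a finite set, so do those of `Sel₀(K_∞, E[p^∞])` (the inclusion
`Sel₀ ↪ Sel` restricted to `p`-torsion is injective). With `FineSelmerDualData.module_finite_of_finite_pTorsion`
/ `finite_quotient_augIdealP_of_finite_pTorsion` this turns "`Sel(E′/ℚ^cyc)[p]` finite" (classical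
`μ = 0`, e.g. from a finite `X(E′/ℚ^cyc)` by Greenberg's Thm. 4.1) into "`X₀(E′/ℚ^cyc)/p` finite".
[cite: CoatesSujatha2005, §3] -/
theorem finite_fineSelmerInfty_pTorsion_of_finite_selmerInfty_pTorsion
    (hfin : Set.Finite {s : W.selmerInfty κ | p • s = 0}) :
    Set.Finite {s : W.fineSelmerInfty κ | p • s = 0} := by
  let f : W.fineSelmerInfty κ → W.selmerInfty κ :=
    fun s ↦ ⟨(s : W.subgroupH1 p κ.kerSubgroup), fineSelmerInfty_le_selmerInfty W κ s.2⟩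
  have hf : Function.Injective f := fun s t hst ↦
    Subtype.ext (congrArg (fun z : W.selmerInfty κ ↦ (z : W.subgroupH1 p κ.kerSubgroup)) hst)
  refine (hfin.preimage hf.injOn).subset fun s hs ↦ ?_
  rw [Set.mem_setOf_eq] at hs
  rw [Set.mem_preimage, Set.mem_setOf_eq]
  have h1 : ((p • s : W.fineSelmerInfty κ) : W.subgroupH1 p κ.kerSubgroup) = 0 := by
    rw [hs]; rfl
  rw [AddSubgroupClass.coe_nsmul] at h1
  apply Subtype.ext
  rw [AddSubgroupClass.coe_nsmul]
  exact h1

end Infty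

end Summit.BirchSwinnertonDyer.BirchSwinnertonDyer.Theorems.FineSelmerLeSelmer

end
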